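import Summits.RiemannHypothesis.RiemannHypothesis.Theorems.Splittings.LinearRayLehmerWindowDefs
import Summits.RiemannHypothesis.RiemannHypothesis.Theorems.UniversalFactorMediumHighCover
import Mathlib.Analysis.Complex.Liouville
import Mathlib.Analysis.Convex.Deriv

/-!
# The linear-factor ray at Lehmer's pair — analytic tools for the dip side

Cell rh-split (D-0116 arm), ENGINE 5 (rh-splitx-eng-5 g4), lane (xviii-D) «LEHMER WINDOW DATA», part
DIP-TOOLS: (i) data lemmas for the grid boxes `ldDipVals` and `ldMaxReHi`; (ii) `Re F(¼+it/2)` (`reSPR`) is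
non-increasing, so the engine's disc/segment constants are uniform on the dip segment; (iii) the vertical
parametrisation `w ↦ F_0(½ + wI)` of the engine's `F_0 = lehmerF t₀ 0` is analytic near the real axis, with
the real derivatives of `u(s) = Re F_0(½+is)`, and **Cauchy's estimate** for its second derivative
(`Complex.norm_iteratedDeriv_le_of_forall_mem_sphere_norm_le` off `UniversalFactor.norm_lehmerF_le_of_mem_sphere`,
`R = ¼`); (iv) the linear-interpolation lemma `u ≤ max(u p, u q) + B(q−p)²/8` under `|u''| ≤ B`
(convexity of `u + (B/2)(x−p)(x−q)`); (v) soundness of the uniform constants `ldDipConsts`.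
HONEST LABEL: RH-free negative-side bookkeeping on the linear-factor ray (RH-strengthening via
`riemannHypothesis_of_exists_linearRay`); not a splitting; nothing here bears on the truth of RH.
-/


set_option linter.dupNamespace false

noncomputable section

namespace Summit.RiemannHypothesis.RiemannHypothesis.Theorems.Splittings.LinearRayLehmerWindow

open Set MeasureTheory Metric Complex
open Literature.NumberTheory.LFunctions Literature.NumberTheory.LFunctions.ZetaNumerics
open Literature.Analysis.ValidatedNumerics Literature.Analysis.ValidatedNumerics.NumericsMP
open Literature.Analysis.SpecialFunctions.Complex (stirlingPrim)

/-! ## Data lemmas -/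

/-- **Soundness of `ldDipVals`**: length and entries. [folklore] -/
theorem ldDipVals_spec (C : UniversalFactor.LCtx) (B N₁ : ℕ) (κ : ℤ) :
    ∀ (n : ℕ) {L : List MC}, ldDipVals C B N₁ κ n = some L →
      L.length = n ∧ ∀ k < n, UniversalFactor.lehmerFBox C (N₁ + k) B κ = some (L.getD k ⟨⟨0, 0⟩, ⟨0, 0⟩⟩)
  | 0, L, h => by
      simp only [ldDipVals, Option.some.injEq] at h
      subst h; simp
  | n + 1, L, h => by
      simp only [ldDipVals, Option.bind_eq_some_iff, Option.map_eq_some_iff] at h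
      obtain ⟨L', hL', F, hF, rfl⟩ := h
      obtain ⟨hlen, hget⟩ := ldDipVals_spec C B N₁ κ n hL'
      refine ⟨by simp [hlen], fun k hk => ?_⟩
      rcases Nat.lt_succ_iff_lt_or_eq.1 hk with hk | hk
      · rw [hget k hk, List.getD_eq_getElem?_getD, List.getD_eq_getElem?_getD,
          List.getElem?_append_left (by omega)]
      · subst hk
        rw [hF, List.getD_eq_getElem?_getD, List.getElem?_append_right (by omega), hlen, Nat.sub_self]
        simp

/-- Every entry's upper real part is at most `ldMaxReHi`. [folklore] -/
theorem le_ldMaxReHi : ∀ (L : List MC) (k : ℕ), k < L.length → (L.getD k ⟨⟨0, 0⟩, ⟨0, 0⟩⟩).re.hi ≤ ldMaxReHi L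
  | [], k, hk => absurd hk (by simp)
  | F :: L, 0, _ => by rw [List.getD_cons_zero, ldMaxReHi]; exact le_max_left _ _
  | F :: L, k + 1, hk => by
      rw [List.getD_cons_succ, ldMaxReHi]
      exact (le_ldMaxReHi L k (by simpa using hk)).trans (le_max_right _ _)

/-! ## `Re F(¼ + it/2)` is non-increasing -/

/-- `reSPR` is antitone on `(0, ∞)`: for `0 < t ≤ t'`, `reSPR t' ≤ reSPR t`. [folklore] -/
theorem reSPR_antitone {t t' : ℝ} (ht : 0 < t) (htt' : t ≤ t') :
    UniversalFactor.reSPR t' ≤ UniversalFactor.reSPR t := by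
  have ht' : 0 < t' := lt_of_lt_of_le ht htt'
  unfold UniversalFactor.reSPR
  have hell : UniversalFactor.ellR t ≤ UniversalFactor.ellR t' := by
    unfold UniversalFactor.ellR
    have h1 : (0 : ℝ) < 1 / 16 + t ^ 2 / 4 := by positivity
    have h2 : 1 / 16 + t ^ 2 / 4 ≤ 1 / 16 + t' ^ 2 / 4 := by nlinarith
    linarith [Real.log_le_log h1 h2]
  have hα : UniversalFactor.alphaR t ≤ UniversalFactor.alphaR t' := by
    unfold UniversalFactor.alphaR
    have : Real.arctan (1 / (2 * t')) ≤ Real.arctan (1 / (2 * t)) :=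
      Real.arctan_strictMono.monotone (one_div_le_one_div_of_le (by positivity) (by linarith))
    linarith
  have hα0 : 0 ≤ UniversalFactor.alphaR t := by
    unfold UniversalFactor.alphaR
    linarith [Real.arctan_lt_pi_div_two (1 / (2 * t))]
  have hprod : t * UniversalFactor.alphaR t ≤ t' * UniversalFactor.alphaR t' :=
    mul_le_mul htt' hα hα0 ht'.le
  linarith

/-- The real part of the Stirling-primitive difference is `reSPR t − reSPR t₀`. [folklore] -/
theorem re_stirlingPrim_sub {t t₀ : ℝ} (ht : 0 < t) (ht₀ : 0 < t₀) :
    (stirlingPrim (thetaArg t) - stirlingPrim (thetaArg t₀)).re =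
      UniversalFactor.reSPR t - UniversalFactor.reSPR t₀ := by
  rw [UniversalFactor.stirlingPrim_thetaArg ht, UniversalFactor.stirlingPrim_thetaArg ht₀]
  simp

/-! ## The vertical parametrisation of `F_0` and its derivatives -/

/-- `F_0` is complex differentiable at `½ + w·I` whenever `|Im w| < ½` (then `0 < Re(½ + wI) < 1`).
[folklore] -/
theorem differentiableAt_Fv (t₀ : ℝ) {w : ℂ} (hw : |w.im| < 1 / 2) :
    DifferentiableAt ℂ (fun w : ℂ => UniversalFactor.lehmerF t₀ 0 (1 / 2 + w * I)) w := by
  have hre : (1 / 2 + w * I).re = 1 / 2 - w.im := by simp; ring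
  have hw' := abs_lt.1 hw
  have h1 : 0 < (1 / 2 + w * I).re := by rw [hre]; linarith
  have h2 : (1 / 2 + w * I) ≠ 1 := by
    intro h
    have := congrArg Complex.re h
    rw [hre, Complex.one_re] at this
    linarith
  have hF : DifferentiableAt ℂ (UniversalFactor.lehmerF t₀ 0) (1 / 2 + w * I) := by
    have e : UniversalFactor.lehmerF t₀ 0 = UniversalFactor.lehmerCore t₀ := by
      funext s; simpa using UniversalFactor.lehmerF_zero t₀ s
    rw [e]
    exact UniversalFactor.differentiableAt_lehmerCore t₀ h1 h2
  have hg : DifferentiableAt ℂ (fun w : ℂ => (1 : ℂ) / 2 + w * I) w := by fun_prop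
  exact hF.comp w hg

/-- `F_0` along the vertical parametrisation is analytic at every real point. [folklore] -/
theorem analyticAt_Fv (t₀ s : ℝ) :
    AnalyticAt ℂ (fun w : ℂ => UniversalFactor.lehmerF t₀ 0 (1 / 2 + w * I)) (s : ℂ) := by
  have hU : IsOpen {w : ℂ | |w.im| < 1 / 2} := by
    have : {w : ℂ | |w.im| < 1 / 2} = Complex.im ⁻¹' Ioo (-(1 / 2)) (1 / 2) := by
      ext w; simp [abs_lt]
    rw [this]
    exact isOpen_Ioo.preimage Complex.continuous_im
  have hd : DifferentiableOn ℂ (fun w : ℂ => UniversalFactor.lehmerF t₀ 0 (1 / 2 + w * I)) {w : ℂ | |w.im| < 1 / 2} :=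
    fun w hw => (differentiableAt_Fv t₀ hw).differentiableWithinAt
  exact hd.analyticAt (hU.mem_nhds (by simp))

/-- `u(s) = Re F_0(½ + is)` has derivative `Re F_0ᵥ'(s)` (`F_0ᵥ(w) = F_0(½ + wI)`). [folklore] -/
theorem hasDerivAt_reFv (t₀ s : ℝ) :
    HasDerivAt (fun s : ℝ => (UniversalFactor.lehmerF t₀ 0 (1 / 2 + (s : ℂ) * I)).re)
      ((deriv (fun w : ℂ => UniversalFactor.lehmerF t₀ 0 (1 / 2 + w * I)) (s : ℂ)).re) s := by
  have h1 : HasDerivAt (fun s : ℝ => UniversalFactor.lehmerF t₀ 0 (1 / 2 + (s : ℂ) * I))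
      (deriv (fun w : ℂ => UniversalFactor.lehmerF t₀ 0 (1 / 2 + w * I)) (s : ℂ)) s :=
    ((analyticAt_Fv t₀ s).differentiableAt).hasDerivAt.comp_ofReal
  have h2 := (Complex.reCLM.hasFDerivAt).comp_hasDerivAt s h1
  simpa [Function.comp_def] using h2

/-- `Re F_0ᵥ'(s)` has derivative `Re F_0ᵥ''(s)`. [folklore] -/
theorem hasDerivAt_reDerivFv (t₀ s : ℝ) :
    HasDerivAt (fun s : ℝ => (deriv (fun w : ℂ => UniversalFactor.lehmerF t₀ 0 (1 / 2 + w * I)) (s : ℂ)).re)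
      ((deriv (deriv (fun w : ℂ => UniversalFactor.lehmerF t₀ 0 (1 / 2 + w * I))) (s : ℂ)).re) s := by
  have h1 : HasDerivAt (fun s : ℝ => deriv (fun w : ℂ => UniversalFactor.lehmerF t₀ 0 (1 / 2 + w * I)) (s : ℂ))
      (deriv (deriv (fun w : ℂ => UniversalFactor.lehmerF t₀ 0 (1 / 2 + w * I))) (s : ℂ)) s :=
    ((analyticAt_Fv t₀ s).deriv.differentiableAt).hasDerivAt.comp_ofReal
  have h2 := (Complex.reCLM.hasFDerivAt).comp_hasDerivAt s h1
  simpa [Function.comp_def] using h2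

/-- **Cauchy's estimate for the second derivative** along the critical line: for `4 ≤ s`, `0 < t₀`,
`‖F_0ᵥ''(s)‖ ≤ 2·M/R²`, `R = ¼`, with `M = 5(s+1)³ exp(¼ + (log s + 3)/8 + (reSPR s − reSPR t₀))` the engine's
disc bound. [folklore] -/
theorem norm_deriv2_Fv_le {t₀ s : ℝ} (hs : 4 ≤ s) (ht₀ : 0 < t₀) :
    ‖deriv (deriv (fun w : ℂ => UniversalFactor.lehmerF t₀ 0 (1 / 2 + w * I))) (s : ℂ)‖ ≤
      2 * (5 * (s + 1) ^ 3 * Real.exp (1 / 4 + (Real.log s + 3) * (1 / 4) / 2 +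
        (UniversalFactor.reSPR s - UniversalFactor.reSPR t₀) + (-0 * (s - t₀) + |(0:ℝ)| * (1 / 4)))) / (1 / 4) ^ 2 := by
  set Fv : ℂ → ℂ := fun w : ℂ => UniversalFactor.lehmerF t₀ 0 (1 / 2 + w * I) with hFv
  have hs0 : 0 < s := by linarith
  -- differentiability on the closed disc of radius 1/4 about `s`
  have hdiff : DifferentiableOn ℂ Fv (closure (ball (s : ℂ) (1 / 4))) := by
    rw [closure_ball (s : ℂ) (by norm_num : (1 / 4 : ℝ) ≠ 0)]
    intro w hw
    refine (differentiableAt_Fv t₀ ?_).differentiableWithinAt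
    rw [mem_closedBall, dist_eq_norm] at hw
    have him : (w - (s : ℂ)).im = w.im := by simp
    have := Complex.abs_im_le_norm (w - (s : ℂ))
    rw [him] at this
    linarith
  have hdc : DiffContOnCl ℂ Fv (ball (s : ℂ) (1 / 4)) := hdiff.diffContOnCl
  -- the sphere bound
  have hD : (stirlingPrim (thetaArg s) - stirlingPrim (thetaArg t₀)).re ≤
      UniversalFactor.reSPR s - UniversalFactor.reSPR t₀ := (re_stirlingPrim_sub hs0 ht₀).le
  have hsph : ∀ z ∈ sphere (s : ℂ) (1 / 4), ‖Fv z‖ ≤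
      5 * (s + 1) ^ 3 * Real.exp (1 / 4 + (Real.log s + 3) * (1 / 4) / 2 +
        (UniversalFactor.reSPR s - UniversalFactor.reSPR t₀) + (-0 * (s - t₀) + |(0:ℝ)| * (1 / 4))) := by
    intro z hz
    have hz' : (1 / 2 + z * I) ∈ sphere ((1 : ℂ) / 2 + (s : ℂ) * I) (1 / 4) := by
      rw [mem_sphere, dist_eq_norm] at hz ⊢
      have e : (1 : ℂ) / 2 + z * I - (1 / 2 + (s : ℂ) * I) = (z - s) * I := by ring
      rw [e, norm_mul, Complex.norm_I, mul_one, hz]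
    have h := UniversalFactor.norm_lehmerF_le_of_mem_sphere (t₀ := t₀) (κ := 0) (T := s) (R := 1 / 4)
      hs (by norm_num) le_rfl hD hz'
    simpa only [hFv] using h
  have hC := Complex.norm_iteratedDeriv_le_of_forall_mem_sphere_norm_le 2 (by norm_num : (0:ℝ) < 1 / 4) hdc hsph
  rw [iteratedDeriv_succ, iteratedDeriv_one] at hC
  have e2 : ((2 : ℕ).factorial : ℝ) = 2 := by norm_num [Nat.factorial]
  rw [e2] at hC
  exact hC

/-! ## Linear interpolation with a second-derivative bound -/

/-- If `u` is twice differentiable on `ℝ` with `|u''| ≤ B` on `[p, q]`, then on `[p, q]`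
`u ≤ max(u p, u q) + B (q − p)²/8` (convexity of `u + (B/2)(x−p)(x−q)`). [folklore] -/
theorem le_max_add_of_deriv2_bound {u u' u'' : ℝ → ℝ} {p q Bd : ℝ} (hpq : p ≤ q)
    (hu : ∀ s, HasDerivAt u (u' s) s) (hu' : ∀ s, HasDerivAt u' (u'' s) s)
    (hB : ∀ s ∈ Icc p q, |u'' s| ≤ Bd) {s : ℝ} (hs : s ∈ Icc p q) :
    u s ≤ max (u p) (u q) + Bd * (q - p) ^ 2 / 8 := by
  have hBd : 0 ≤ Bd := (abs_nonneg _).trans (hB p (left_mem_Icc.2 hpq))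
  set ψ : ℝ → ℝ := fun x => u x + Bd / 2 * ((x - p) * (x - q)) with hψ
  have hψ' : ∀ x, HasDerivAt ψ (u' x + Bd / 2 * (2 * x - p - q)) x := by
    intro x
    have h1 : HasDerivAt (fun x : ℝ => (x - p) * (x - q)) ((1 : ℝ) * (x - q) + (x - p) * 1) x :=
      ((hasDerivAt_id x).sub_const p).mul ((hasDerivAt_id x).sub_const q)
    have h2 := (hu x).add (h1.const_mul (Bd / 2))
    refine h2.congr_deriv ?_
    ring
  have hψ'' : ∀ x, HasDerivAt (fun x => u' x + Bd / 2 * (2 * x - p - q)) (u'' x + Bd) x := by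
    intro x
    have h1 : HasDerivAt (fun x : ℝ => 2 * x - p - q) ((2 : ℝ) * 1) x := by
      simpa using (((hasDerivAt_id x).const_mul (2:ℝ)).sub_const p).sub_const q
    have h2 := (hu' x).add (h1.const_mul (Bd / 2))
    refine h2.congr_deriv ?_
    ring
  have hdψ : deriv ψ = fun x => u' x + Bd / 2 * (2 * x - p - q) := funext fun x => (hψ' x).deriv
  have hd2ψ : deriv (deriv ψ) = fun x => u'' x + Bd := by
    rw [hdψ]; exact funext fun x => (hψ'' x).deriv
  have hconv : ConvexOn ℝ (Icc p q) ψ := by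
    refine convexOn_of_deriv2_nonneg (convex_Icc p q) ?_ ?_ ?_ ?_
    · exact fun x _ => (hψ' x).continuousAt.continuousWithinAt
    · exact fun x _ => (hψ' x).differentiableAt.differentiableWithinAt
    · rw [hdψ]; exact fun x _ => (hψ'' x).differentiableAt.differentiableWithinAt
    · intro x hx
      rw [interior_Icc] at hx
      have hx' : x ∈ Icc p q := Ioo_subset_Icc_self hx
      show 0 ≤ deriv (deriv ψ) x
      rw [hd2ψ]
      have := (abs_le.1 (hB x hx')).1
      show 0 ≤ u'' x + Bd
      linarith
  have hle : ψ s ≤ max (ψ p) (ψ q) :=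
    hconv.le_on_segment (left_mem_Icc.2 hpq) (right_mem_Icc.2 hpq) (by rw [segment_eq_Icc hpq]; exact hs)
  have hψp : ψ p = u p := by simp [hψ]
  have hψq : ψ q = u q := by simp [hψ]
  rw [hψp, hψq] at hle
  have hψs : ψ s = u s + Bd / 2 * ((s - p) * (s - q)) := rfl
  have hprod : -((s - p) * (s - q)) ≤ (q - p) ^ 2 / 4 := by nlinarith [sq_nonneg ((s - p) - (q - s))]
  nlinarith [hle, hψs, hprod, hBd, hs.1, hs.2]

/-! ## Uniform constants on the dip segment -/

/-- **Soundness of `ldDipConsts`**: `M* ≥ 5(t₀+1)³ exp(¼ + (log t₀+3)/8 + (reSPR t₁ − reSPR t₀))` and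
`Mseg ≥ 25.3 (t₀+1)² exp(reSPR t₁ − reSPR t₀)`, `t₁ = N₁/B`. [folklore] -/
theorem ldDipConsts_sound {C : UniversalFactor.LCtx} (hC : C.Valid) (hCt0 : C.t0 = UniversalFactor.lehmerT0)
    {B N₁ : ℕ} (hB : 0 < B) (hBN : B ≤ N₁) {Mstar Mseg : ℚ} (h : ldDipConsts C B N₁ = some (Mstar, Mseg)) :
    5 * (UniversalFactor.lehmerT0 + 1) ^ 3 * Real.exp (1 / 4 + (Real.log UniversalFactor.lehmerT0 + 3) / 8 +
        (UniversalFactor.reSPR ((N₁ : ℝ) / B) - UniversalFactor.reSPR UniversalFactor.lehmerT0)) ≤ (Mstar : ℝ) ∧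
      253 / 10 * (UniversalFactor.lehmerT0 + 1) ^ 2 *
        Real.exp (UniversalFactor.reSPR ((N₁ : ℝ) / B) - UniversalFactor.reSPR UniversalFactor.lehmerT0) ≤ (Mseg : ℝ) := by
  have hS := hC.tv.S_pos
  have hSr : (0 : ℝ) < C.T.S := by exact_mod_cast hS
  unfold ldDipConsts at h
  simp only [Option.bind_eq_some_iff, Option.map_eq_some_iff, Prod.mk.injEq] at h
  obtain ⟨P, hP, LN, hLN, LD, hLD, EM, hEM, ES, hES, hM1, hM2⟩ := h
  have msp := (UniversalFactor.mem_spOf hS hC.tv.mem_pi hB hBN hP).1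
  have m0 := hC.mem_reSP0
  rw [hCt0] at m0
  have mD := MI.mem_sub msp m0
  have mLN := MI.mem_logNat hS hLN
  have mLD := MI.mem_logNat hS hLD
  have hlog : Real.log UniversalFactor.lehmerT0 = Real.log UniversalFactor.lehmerT0N - Real.log UniversalFactor.lehmerT0D := by
    unfold UniversalFactor.lehmerT0
    rw [Real.log_div (by unfold UniversalFactor.lehmerT0N; norm_num) (by unfold UniversalFactor.lehmerT0D; norm_num)]
  have mX : MI.mem C.T.S (1 / 4 + (Real.log UniversalFactor.lehmerT0 + 3) / 8 +
      (UniversalFactor.reSPR ((N₁ : ℝ) / B) - UniversalFactor.reSPR UniversalFactor.lehmerT0))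
      ((((MI.ofFrac C.T.S 1 4).add (((LN.sub LD).add (MI.ofInt C.T.S 3)).divNat 8)).add (P.1.sub C.reSP0))) := by
    have m14 : MI.mem C.T.S ((1 : ℝ) / 4) (MI.ofFrac C.T.S 1 4) := by
      have := MI.mem_ofFrac C.T.S 1 (by norm_num : 0 < 4); simpa using this
    have m3 : MI.mem C.T.S (3 : ℝ) (MI.ofInt C.T.S 3) := by
      have := MI.mem_ofInt C.T.S 3; simpa using this
    have mL := MI.mem_divNat (MI.mem_add (MI.mem_sub mLN mLD) m3) (by norm_num : 0 < 8)
    have := MI.mem_add (MI.mem_add m14 mL) mD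
    rw [hlog]
    convert this using 1
    push_cast
    ring
  have mEM := MI.mem_exp hS hEM mX
  have mES := MI.mem_exp hS hES mD
  have hEM := MI.le_hi_div hS mEM
  have hES := MI.le_hi_div hS mES
  have ht1 : UniversalFactor.lehmerT0 + 1 =
      ((UniversalFactor.lehmerT0N : ℝ) + UniversalFactor.lehmerT0D) / UniversalFactor.lehmerT0D := by
    unfold UniversalFactor.lehmerT0 UniversalFactor.lehmerT0N UniversalFactor.lehmerT0D; norm_num
  constructor
  · rw [← hM1, ht1]
    push_cast
    have h5 : (0 : ℝ) ≤ 5 * (((UniversalFactor.lehmerT0N : ℝ) + UniversalFactor.lehmerT0D) / UniversalFactor.lehmerT0D) ^ 3 := by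
      positivity
    exact mul_le_mul_of_nonneg_left hEM h5
  · rw [← hM2, ht1]
    push_cast
    have h5 : (0 : ℝ) ≤ 253 / 10 * (((UniversalFactor.lehmerT0N : ℝ) + UniversalFactor.lehmerT0D) / UniversalFactor.lehmerT0D) ^ 2 := by
      positivity
    exact mul_le_mul_of_nonneg_left hES h5

end Summit.RiemannHypothesis.RiemannHypothesis.Theorems.Splittings.LinearRayLehmerWindow

end
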